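import Summits.ResolutionOfSingularities.ResolutionOfSingularities.Theorems.MarkedTransferCampaignW46WWalkNRStepCore
import Summits.ResolutionOfSingularities.ResolutionOfSingularities.Theorems.MarkedTransferCampaignW46WWalkNRPoint
import Summits.ResolutionOfSingularities.ResolutionOfSingularities.Theorems.MarkedTransferCampaignW46WWalkMapModel
import Summits.ResolutionOfSingularities.ResolutionOfSingularities.Theorems.MarkedTransferCampaignW46MohWindowShadeFormalNRStep
import Summits.ResolutionOfSingularities.ResolutionOfSingularities.Theorems.MarkedTransferCampaignW46WWalkStep
import Mathlib.FieldTheory.IsAlgClosed.Basic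
import HarnessLib

/-!
# [OURS · L1 W4.6 rung (iii-2)] THE W-WALK STEP AT AN ARBITRARY CLOSED SINGULAR POINT (scheme level): the `w`-anchor of the child lives
# over the residue field `K(λ)` of the point, and its model is `chartT p λ (f ⊗ K(λ))` (`T`-step) or `chartT p 0 (swapTY (f ⊗ K(λ)))`
# (sharp-vertical step)

Cell `res-hironaka`, LADDER-RESOLUTION rung L (D-0089), slot W4.6 rung (iii); seat res-L1-s46-pv-5 (gen 7). Host route MarkedTransfer,
`--supports stmt-ResolutionOfSingularities-16155 --as helper`; kind proof (def-free). Plan `HOME/L/res-L1-s46-pv-5/NOTES.md` (gen 7, file F4).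
Template (case analysis on the Rees chart, reindexing of torus points, exclusion of the `z`-chart — copied): res-L1-s46-pv-6's
`…FormalNRStep.exists_formalNRAnchor_step`; the ring-level core is res-L1-s46-pv-6 (gen 8)'s `…WWalkNRStepCore` (`T`/`V` forms of the
non-rational step for a GENERAL germ) and `…WWalkNRPoint` (`f₀ ≡ u c_z^p`), landed in parallel with this seat's identical drafts (HOME
`L/res-L1-s46-pv-5/wwalk7/NRStepCore.lean`, `NRStepForms.lean`) — imported, not forked; gen 6's rational version is `…WWalkStep.exists_wAnchor_step`.

WHAT (`exists_wAnchor_step_nr`). Let `π : Z′ → Z` be the blow-up of an ambient datum along the reduced closed point `ξ = π(ξ′) ∈ Sing(E)`,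
`E.b = p`, both stalks regular of embedding dimension `3`, `ξ′ ∈ Sing(E′)` ANY closed point over `ξ` (no rationality), and let `J_ξ = (f₀)` carry
a `w`-anchor `E₀(f₀) = w · (z^p + f)` over a PERFECT field `K₀` with `ord f ≥ p + 1`, `ιΩ : K₀ → Ω` into an algebraically closed field. Then
`J′_{ξ′} = (f′)` carries a `w`-anchor `E′(f′) = w′ · (z^p + f₁)` over a perfect field `K₁` with `φ : K₀ → K₁`, `ι₁ : K₁ → Ω`, `ι₁ ∘ φ = ιΩ`,
and EITHER `f₁ = chartT p λ (f ⊗ K₁)` for some `λ ∈ K₁` OR `f₁ = chartT p 0 (swapTY (f ⊗ K₁))`.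

HONEST FRAMING. OURS; nothing here is a statement of H. Hironaka's manuscript [Hironaka2017] (Def. 2.1 p.5, Th. 16.6 p.84 — scope only) and
nothing of it is used. AI-written; AI review is weaker than expert review. No `sorry`; axioms standard. References: Stacks Project Tag 0804;
H. Matsumura (1986) Thm. 8.11 [Matsumura1987]; H. Hauser, Bull. AMS 47 (2010) §§F–G [Hauser2010]. [StacksProject] [folklore]
-/

noncomputable section

set_option linter.dupNamespace false -- mandated namespace of this single-conjunct summit

open IsLocalRing MvPowerSeries

namespace Summit.ResolutionOfSingularities.ResolutionOfSingularities.Theorems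

namespace CampaignW46

namespace WWalk

open Literature.AlgebraicGeometry.Resolution
open CampaignW46.FormalChart
open CampaignW46.ChartPoint
open CampaignW46.MohWindowShadeFormalNR (exists_stalk_chartData_nr irreducible_map_ev₀ e_mem_maximalIdeal_of_transform false_of_zChart_nr
  span_origin_of_mem exists_reindex_nr)
open MohWindowShadeFormalStep (exists_other_index)
open CampaignW46.WWalkNR (exists_ringEquiv_transform_wAnchor_nr_T exists_ringEquiv_transform_wAnchor_nr_V exists_unit_sub_mul_pow_mem_of_lowVanish)

/-! ## §1 The grown coefficient field embeds into any algebraically closed field -/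

section Embedding

variable {K₀ Ω : Type} [Field K₀] [Field Ω] [IsAlgClosed Ω] (ιΩ : K₀ →+* Ω)

/-- `K(λ) = AdjoinRoot π` (`π` irreducible) embeds into an algebraically closed `Ω ⊇ K`, extending `K → Ω`. [folklore] -/
theorem exists_ringHom_adjoinRoot (π : Polynomial K₀) [hπ : Fact (Irreducible π)] :
    ∃ ι₁ : AdjoinRoot π →+* Ω, ∀ l, ι₁ (AdjoinRoot.of π l) = ιΩ l := by
  have hdeg : (π.map ιΩ).degree ≠ 0 := by
    rw [Polynomial.degree_map]
    exact fun h => hπ.out.not_isUnit (Polynomial.isUnit_iff_degree_eq_zero.mpr h)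
  obtain ⟨θ, hθ⟩ := IsAlgClosed.exists_root (π.map ιΩ) hdeg
  have hev : Polynomial.eval₂ ιΩ θ π = 0 := by rw [Polynomial.eval₂_eq_eval_map]; exact hθ
  exact ⟨AdjoinRoot.lift ιΩ θ hev, fun l => AdjoinRoot.lift_of hev⟩

end Embedding

/-! ## §2 The step at an arbitrary closed singular point -/

section Scheme

open CategoryTheory AlgebraicGeometry TopologicalSpace
open Literature.AlgebraicGeometry.Hironaka2017.S02Preliminaries
open Literature.AlgebraicGeometry.Hironaka2017.Datum
open Scheme.IdealSheafData

variable {p : ℕ} [hp : Fact p.Prime] {K : Type} [Field K] [CharP K p]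
  {K₀ : Type} [Field K₀] [CharP K₀ p] [PerfectRing K₀ p]
  {Ω : Type} [Field Ω] [IsAlgClosed Ω] (ιΩ : K₀ →+* Ω)

/-- [OURS · L1 W4.6 rung (iii-2)] **THE W-WALK STEP AT AN ARBITRARY CLOSED SINGULAR POINT.** See the module docstring. NOT a statement of
the manuscript. [cite: StacksProject, Tag 0804] [cite: Matsumura1987, Thm. 8.11] -/
theorem exists_wAnchor_step_nr {A A' : AmbientDatum p K} (π : A'.Z ⟶ A.Z) (D : Closeds A.Z) (hπ : IsBlowup π (vanishingIdeal D))
    {E : IdealExponent A.Z} (hb : E.b = p) {ξ' : A'.Z} (hD : (D : Set A.Z) = {π.base ξ'}) (hξ : π.base ξ' ∈ E.sing)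
    (hξ' : ξ' ∈ (E.transform π D).sing) (h3 : (maximalIdeal (A.Z.presheaf.stalk (π.base ξ'))).spanFinrank = 3)
    (hreg' : IsRegularLocalRing (A'.Z.presheaf.stalk ξ')) (h3' : (maximalIdeal (A'.Z.presheaf.stalk ξ')).spanFinrank = 3)
    (E₀ : AdicCompletion (maximalIdeal (A.Z.presheaf.stalk (π.base ξ'))) (A.Z.presheaf.stalk (π.base ξ')) ≃+*
      MvPowerSeries (Option (Fin 2)) K₀)
    {f₀ : A.Z.presheaf.stalk (π.base ξ')} (hJ : stalkIdeal E.J (π.base ξ') = Ideal.span {f₀}) {w : MvPowerSeries (Option (Fin 2)) K₀}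
    (hw : IsUnit w) (f : MvPowerSeries (Option (Fin 2)) K₀) (hfP2 : LowVanish (p + 1) f)
    (hE₀ : E₀ (algebraMap _ _ f₀) = w * (MvPowerSeries.X none ^ p + f)) :
    ∃ (K₁ : Type) (_ : Field K₁) (_ : CharP K₁ p) (_ : PerfectField K₁) (φ : K₀ →+* K₁) (ι₁ : K₁ →+* Ω)
      (E' : AdicCompletion (maximalIdeal (A'.Z.presheaf.stalk ξ')) (A'.Z.presheaf.stalk ξ') ≃+* MvPowerSeries (Option (Fin 2)) K₁)
      (f' : A'.Z.presheaf.stalk ξ') (w' : MvPowerSeries (Option (Fin 2)) K₁),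
      (∀ l, ι₁ (φ l) = ιΩ l) ∧ stalkIdeal (E.transform π D).J ξ' = Ideal.span {f'} ∧ IsUnit w' ∧
      ((∃ l : K₁, E' (algebraMap _ _ f') = w' * (MvPowerSeries.X none ^ p + chartT p l (MvPowerSeries.map φ f))) ∨
        E' (algebraMap _ _ f') = w' * (MvPowerSeries.X none ^ p + chartT p (0 : K₁) (swapTY (MvPowerSeries.map φ f)))) := by
  classical
  haveI : IsLocallyNoetherian A'.Z := ambient_isLocallyNoetherian A'
  haveI : IsRegularLocalRing (A.Z.presheaf.stalk (π.base ξ')) := ambient_isRegular A _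
  haveI := hreg'
  haveI : PerfectField K₀ := PerfectRing.toPerfectField K₀ p
  set g := (π.stalkMap ξ').hom with hgdef
  have hloc : IsLocalHom g := inferInstance
  have hg : (maximalIdeal (A.Z.presheaf.stalk (π.base ξ'))).map g ≤ maximalIdeal (A'.Z.presheaf.stalk ξ') :=
    ((IsLocalRing.local_hom_TFAE g).out 0 2).mp hloc
  -- an adapted regular system of parameters at `π ξ′`
  obtain ⟨c, hc, hcX⟩ := exists_rsop_adapted E₀
  have hcl : IsClosed ({π.base ξ'} : Set A.Z) := hD ▸ D.isClosed
  have hcJ : Ideal.span (Set.range c) = stalkIdeal (vanishingIdeal D) (π.base ξ') := by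
    rw [hc, stalkIdeal_vanishingIdeal_eq_maximalIdeal_of_closure_eq]
    rw [hD, hcl.closure_eq]
  have hd' : (maximalIdeal (A.Z.presheaf.stalk (π.base ξ'))).spanFinrank = Fintype.card (Option (Fin 2)) := by rw [h3]; simp
  have hdimL : ringKrullDim (A'.Z.presheaf.stalk ξ') = Fintype.card (Option (Fin 2)) := by
    have h := IsRegularLocalRing.spanFinrank_maximalIdeal (R := A'.Z.presheaf.stalk ξ')
    rw [h3'] at h; rw [← h]; simp
  have hdimL3 : ringKrullDim (A'.Z.presheaf.stalk ξ') = 3 := by rw [hdimL]; simp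
  obtain ⟨i, e, he, hei, hnzd, hNoeth, hcont⟩ := exists_stalk_chartData_nr hπ ξ' c hcJ hc hd' hdimL
  haveI := hNoeth
  -- `f₀ ∈ 𝔪^p` and `f₀ ≡ u c_z^p (mod 𝔪^{p+1})`
  have hf₀𝔪 : f₀ ∈ maximalIdeal (A.Z.presheaf.stalk (π.base ξ')) ^ p := by
    have h := (le_idealOrder_iff E.J _ E.b).mp hξ
    rw [hJ, Ideal.span_singleton_le_iff_mem, hb] at h
    exact h
  obtain ⟨u, hu, hf₀u⟩ := exists_unit_sub_mul_pow_mem_of_lowVanish E₀ c hcX f₀ w hw f hfP2 hE₀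
  -- the controlled transform in the chart `c_i` and its singularity
  obtain ⟨f', hf'⟩ := exists_eq_pow_mul_of_mem_pow g c hc i e he hf₀𝔪
  have hJ' : stalkIdeal (E.transform π D).J ξ' = Ideal.span {f'} :=
    stalkIdeal_transform_eq_span hπ ξ' c hcJ i e he hnzd E f₀ hJ f' (by rw [hb]; exact hf')
  have hf'𝔪 : f' ∈ maximalIdeal (A'.Z.presheaf.stalk ξ') ^ p := by
    have h := (mem_sing_transform_iff E ξ' f' hJ').mp hξ'
    rwa [hb] at h
  have hf'𝔪1 : f' ∈ maximalIdeal (A'.Z.presheaf.stalk ξ') := Ideal.pow_le_self hp.out.ne_zero hf'𝔪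
  -- the conclusion from non-rational chart data in a `u`-chart `some j₀` in the Hauser–Wagner frame
  have tail : ∀ (j₀ j₁ : Fin 2) (hj : j₁ ≠ j₀) (htwo : ∀ l, l = j₀ ∨ l = j₁) (e : Option (Fin 2) → A'.Z.presheaf.stalk ξ')
      (πR : Polynomial (A.Z.presheaf.stalk (π.base ξ'))),
      (∀ j, g (c j) = g (c (some j₀)) * e j) → g (c (some j₀)) ∈ nonZeroDivisors (A'.Z.presheaf.stalk ξ') → πR.Monic →
      Irreducible (πR.map (residue (A.Z.presheaf.stalk (π.base ξ')))) →
      Ideal.span {g (c (some j₀)), e none, (πR.map g).eval (e (some j₁))} = maximalIdeal (A'.Z.presheaf.stalk ξ') →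
      (∀ y : A'.Z.presheaf.stalk ξ', ∃ P : Polynomial (A.Z.presheaf.stalk (π.base ξ')), y - (P.map g).eval (e (some j₁)) ∈ maximalIdeal _) →
      (j₀ = 1 → πR.map ((MvPowerSeries.constantCoeff.comp (E₀ : AdicCompletion (maximalIdeal (A.Z.presheaf.stalk (π.base ξ'))) (A.Z.presheaf.stalk (π.base ξ')) →+*
        MvPowerSeries (Option (Fin 2)) K₀)).comp (algebraMap (A.Z.presheaf.stalk (π.base ξ')) _)) = Polynomial.X) →
      ∃ (K₁ : Type) (_ : Field K₁) (_ : CharP K₁ p) (_ : PerfectField K₁) (φ : K₀ →+* K₁) (ι₁ : K₁ →+* Ω)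
        (E' : AdicCompletion (maximalIdeal (A'.Z.presheaf.stalk ξ')) (A'.Z.presheaf.stalk ξ') ≃+* MvPowerSeries (Option (Fin 2)) K₁)
        (f' : A'.Z.presheaf.stalk ξ') (w' : MvPowerSeries (Option (Fin 2)) K₁),
        (∀ l, ι₁ (φ l) = ιΩ l) ∧ stalkIdeal (E.transform π D).J ξ' = Ideal.span {f'} ∧ IsUnit w' ∧
        ((∃ l : K₁, E' (algebraMap _ _ f') = w' * (MvPowerSeries.X none ^ p + chartT p l (MvPowerSeries.map φ f))) ∨
          E' (algebraMap _ _ f') = w' * (MvPowerSeries.X none ^ p + chartT p (0 : K₁) (swapTY (MvPowerSeries.map φ f)))) := by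
    intro j₀ j₁ hj htwo e πR he hnzd hm hirr hgen hres hHW
    set ev₀ := (MvPowerSeries.constantCoeff.comp (E₀ : AdicCompletion (maximalIdeal (A.Z.presheaf.stalk (π.base ξ'))) (A.Z.presheaf.stalk (π.base ξ')) →+*
        MvPowerSeries (Option (Fin 2)) K₀)).comp
      (algebraMap (A.Z.presheaf.stalk (π.base ξ')) (AdicCompletion (maximalIdeal (A.Z.presheaf.stalk (π.base ξ'))) (A.Z.presheaf.stalk (π.base ξ'))))
      with hev₀
    set π₀ := πR.map ev₀ with hπ₀
    have hirr₀ : Irreducible π₀ := irreducible_map_ev₀ E₀ hirr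
    haveI : Fact (Irreducible π₀) := ⟨hirr₀⟩
    haveI : Module.Finite K₀ (AdjoinRoot π₀) := (AdjoinRoot.powerBasis hirr₀.ne_zero).finite
    haveI : PerfectField (AdjoinRoot π₀) := Algebra.IsAlgebraic.perfectField K₀
    haveI : CharP (AdjoinRoot π₀) p := charP_of_injective_ringHom (AdjoinRoot.of π₀).injective p
    obtain ⟨ι₁, hι₁⟩ := exists_ringHom_adjoinRoot ιΩ π₀
    obtain ⟨f'', hf''⟩ := exists_eq_pow_mul_of_mem_pow g c hc (some j₀) e he hf₀𝔪
    have hJ'' : stalkIdeal (E.transform π D).J ξ' = Ideal.span {f''} :=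
      stalkIdeal_transform_eq_span hπ ξ' c hcJ (some j₀) e he hnzd E f₀ hJ f'' (by rw [hb]; exact hf'')
    by_cases h0 : j₀ = 0
    · obtain ⟨E', w', hw', -, hE'⟩ := exists_ringEquiv_transform_wAnchor_nr_T g hg E₀ c hc hcX hj htwo e he πR hm π₀ rfl hgen hres hdimL3 h0
        f hfP2 f₀ w hw hE₀ f'' hf''
      exact ⟨AdjoinRoot π₀, inferInstance, inferInstance, inferInstance, AdjoinRoot.of π₀, ι₁, E', f'', w', hι₁, hJ'', hw', Or.inl ⟨_, hE'⟩⟩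
    · have h1 : j₀ = 1 := by
        rcases j₀ with ⟨_ | _ | k, hk⟩
        · exact absurd rfl h0
        · rfl
        · omega
      obtain ⟨E', w', hw', -, hE'⟩ := exists_ringEquiv_transform_wAnchor_nr_V g hg E₀ c hc hcX hj htwo e he πR hm π₀ rfl hgen hres hdimL3 h1
        (hHW h1) f hfP2 f₀ w hw hE₀ f'' hf''
      exact ⟨AdjoinRoot π₀, inferInstance, inferInstance, inferInstance, AdjoinRoot.of π₀, ι₁, E', f'', w', hι₁, hJ'', hw', Or.inr hE'⟩
  -- case analysis on the chart delivered by the Rees-chart presentation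
  cases i with
  | none => exact (false_of_zChart_nr c hc g hg e he hnzd hu hf₀u f' hf' hf'𝔪1).elim
  | some i₀ =>
    have hez : e none ∈ maximalIdeal (A'.Z.presheaf.stalk ξ') := e_mem_maximalIdeal_of_transform c hc g hg e he hnzd hu hf₀u f' hf' hf'𝔪1
    obtain ⟨i₁, hi, htwo⟩ := exists_other_index i₀
    have hall : ∀ j : Option (Fin 2), j = some i₀ ∨ j = some i₁ ∨ j = none := by
      intro j
      cases j with
      | none => exact Or.inr (Or.inr rfl)
      | some l => rcases htwo l with rfl | rfl <;> simp
    obtain ⟨πR, hm, hirr, hgen, hres⟩ := hcont (some i₁) none (fun h => hi (Option.some_injective _ h)) (Option.some_ne_none i₀).symm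
      (Option.some_ne_none i₁) hall hez
    by_cases hHW : i₀ = 1 → e (some i₁) ∈ maximalIdeal (A'.Z.presheaf.stalk ξ')
    · by_cases h1 : i₀ = 1
      · -- the origin of the chart `u₁`: `π̃ := X`
        exact tail i₀ i₁ hi htwo e Polynomial.X he hnzd Polynomial.monic_X (by rw [Polynomial.map_X]; exact Polynomial.irreducible_X)
          (span_origin_of_mem c hc g e he πR hgen (hHW h1)) (by simpa only [Polynomial.map_X, Polynomial.eval_X] using hres)
          (fun _ => by rw [Polynomial.map_X])
      · exact tail i₀ i₁ hi htwo e πR he hnzd hm hirr hgen hres (fun h => absurd h h1)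
    · -- a torus point delivered in the chart `u₁`: re-read it in the chart `u₀`
      rw [Classical.not_imp] at hHW
      obtain ⟨h1, hey⟩ := hHW
      have hv : IsUnit (e (some i₁)) := (IsLocalRing.notMem_maximalIdeal).mp hey
      obtain ⟨v', hvv'⟩ := hv.exists_right_inv
      obtain ⟨ρR, hρm, hρirr, hgen', hres'⟩ :=
        exists_reindex_nr g hg (g (c (some i₀))) (e none) (e (some i₁)) v' hvv' πR hm hirr hgen hres
      set e'' : Option (Fin 2) → A'.Z.presheaf.stalk ξ' := fun j => e j * v' with he''def
      have he'' : ∀ j, g (c j) = g (c (some i₁)) * e'' j := fun j => by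
        rw [he''def]; dsimp only
        rw [he (some i₁), he j]
        calc g (c (some i₀)) * e j = g (c (some i₀)) * (e (some i₁) * v') * e j := by rw [hvv', mul_one]
          _ = g (c (some i₀)) * e (some i₁) * (e j * v') := by ring
      have hnzd'' : g (c (some i₁)) ∈ nonZeroDivisors (A'.Z.presheaf.stalk ξ') := by
        rw [he (some i₁)]; exact mul_mem hnzd hv.mem_nonZeroDivisors
      have he''0 : e'' (some i₀) = v' := by rw [he''def]; dsimp only; rw [hei, one_mul]
      have he''z : e'' none = e none * v' := rfl
      have hgen'' : Ideal.span {g (c (some i₁)), e'' none, (ρR.map g).eval (e'' (some i₀))} = maximalIdeal (A'.Z.presheaf.stalk ξ') := by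
        rw [he''0, he''z, he (some i₁)]; exact hgen'
      have hres'' : ∀ y : A'.Z.presheaf.stalk ξ', ∃ Q : Polynomial (A.Z.presheaf.stalk (π.base ξ')),
          y - (Q.map g).eval (e'' (some i₀)) ∈ maximalIdeal _ := fun y => by rw [he''0]; exact hres' y
      have htwo' : ∀ l, l = i₁ ∨ l = i₀ := fun l => (htwo l).symm
      have hi₁ : i₁ ≠ 1 := fun h => hi (h.trans h1.symm)
      exact tail i₁ i₀ (Ne.symm hi) htwo' e'' ρR he'' hnzd'' hρm hρirr hgen'' hres'' (fun h => absurd h hi₁)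

end Scheme

end WWalk

end CampaignW46

end Summit.ResolutionOfSingularities.ResolutionOfSingularities.Theorems

end
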